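import Mathlib
import HarnessLib
import Literature.Computability.AlgebraicComplexity.ArithCircuit
import Literature.Computability.AlgebraicComplexity.CircuitDepth
import Literature.Computability.AlgebraicComplexity.StandardFamilies
import Literature.Computability.AlgebraicComplexity.RealTauConjectureDepthFour
import Literature.Computability.AlgebraicComplexity.AndrewsForbes2022BorderComposition
import Literature.Computability.AlgebraicComplexity.DepthThreeChasmCircuits
import Literature.Computability.AlgebraicComplexity.ValiantBooleanBridge
import Literature.Computability.Complexity.Circuit
import Literature.Barriers.ValiantsHypothesis.AlgebraicNaturalProofs
import Summits.ValiantsHypothesis.ValiantsHypothesis.Theorems.SuccinctLiftCircuitCodes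
import Summits.ValiantsHypothesis.ValiantsHypothesis.Theorems.SuccinctLiftDescriptionDial
import Summits.ValiantsHypothesis.ValiantsHypothesis.Theorems.SuccinctLiftDescriptionCount

/-!
# Succinct lift — w10: the natural column — every notch of the description dial is a finite class,
# and its hardness IS an algebraically natural proof (Forbes–Shpilka–Volk Def. 1) against that class

Route `route-ValiantsHypothesis-SuccinctLift` (lens 2: natural-proofs / succinctness axis), generation 8.

The route's deciding crux `A = SuccinctPerHardLog3 = ¬ PerEasySuccinctCF (fun n c => n + c) Δ₁` says: for every `c`,
for some `n`, `PER_n` is not in the class `SuccinctClass β Δ₁ n c` (`β n c = n + c`) of polynomials computed by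
constant-free depth-`Δ₁(n)` circuits with `n^c + c` wires whose code word has a `B₂`-description with `β n c` gates.
This file puts the lens's own axis — ALGEBRAICALLY NATURAL PROOFS (Forbes–Shpilka–Volk 2018 Def. 1, the tree's
`Literature.Barriers.ValiantsHypothesis.IsNaturalProof`) — onto the dial, in kernel:

* §1 `exists_isNaturalProof_of_finite` — against a FINITE class `𝒞` every non-member `h` has a natural proof: the
  product, over `g ∈ 𝒞`, of one affine form `c_{m_g} - coeff_{m_g}(g)` in the coefficient variables, of degree
  `≤ |𝒞|` (CKRST 2020 §1.4's "finite classes trivially have equations", made quantitative); and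
  `not_mem_of_isNaturalProof` (soundness);
* §2 `SuccinctClass`, `CFClass` — the notches of the dial as CLASSES of polynomials; `perEasySuccinctCF_iff_mem`,
  `perEasyCF_iff_mem` (`Iff.rfl`); `cfClass_finite`, `succinctClass_finite` — every notch is a finite class (via the
  constant-free normal form and the code-length bound of `SuccinctLiftCircuitCodes.lean`: at most
  `(L + 1) · 2^L` members, `L = 8 (n² + n^c + c + 27)²`, whatever the budget — `ncard_cfClass_le`);
* §3 `perHardDesc_iff_natSep` — for EVERY budget `β` and depth `Δ`:
  `¬ PerEasySuccinctCF β Δ ↔ ∀ c, ∃ n, ∃ D, IsNaturalProof univ (SuccinctClass β Δ n c) {deg ≤ |class|} D ∧ D(PER_n) ≠ 0`;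
  at `β n c = n + c`, `Δ = Δ₁` the left side is the crux `A` verbatim (`succinctPerHardLog3_iff_natSep`), at
  `β n c = n^c + c` it is the top notch `PerHardLog3CF` (`perHardLog3CF_iff_natSep`);
* §4 the WIDTH-PINNED dial `∃ c, ∀ n, PER_n ∈ PinnedClass Δ n c (canonWidth n c) (β n c)` (description at the
  canonical width `canonWidth n c = ⌊log₂ codeLen⌋ + 1`, code word `≤ 2^canonWidth`: no heavy padding by empty gates): `perHardPinned_of_perHardSuccinct`
  (`A ⟹ A′`; the converse — padding removal at no cost in the budget — is NOT claimed: the notch `SuccinctClass` admits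
  un-normalised witnesses whose address width is not bounded by the budget, a typing observation on `A`) and
  `perHardPinned_iff_natSep` — `A′` IS a natural proof of BUDGET-SENSITIVE degree `≤ (2^w₀ + 1) · descCount w₀ β`
  (companion file `SuccinctLiftDescriptionCount.lean`: `ncard_pinnedClass_le`, `descCount_le_pow`): `2^{O(n log n)}`,
  polynomial in `N_n = C(n² + n, n)`, at `β = n + c`, versus `2^{Θ(n^{2c})}` at the top notch (route file §Gen 8).

References: Forbes–Shpilka–Volk 2018 (`ForbesShpilkaVolk2018`, Def. 1, Thm. 4, Question 6), Chatterjee–Kumar–Ramya–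
Saptharishi–Tengse 2020 (`ChatterjeeKumarRamyaSaptharishiTengse2020`, Thm. 1.1, §1.4, §6 open problem `VP⁰`),
Grochow–Kumar–Saks–Saraf 2017 (`GrochowKumarSaksSaraf2017`, §1.1), Chen–Kabanets 2012 (`ChenKabanets2012`, Def. 2.1),
Bürgisser 2000 (`Burgisser2000`, §1.4).
-/

namespace Summit.ValiantsHypothesis.ValiantsHypothesis.Theorems.SuccinctLift

open Literature.Computability.AlgebraicComplexity Literature.Computability.Complexity Computability
open Literature.Barriers.ValiantsHypothesis MvPolynomial
open ArithCircuit

noncomputable section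

/-! ### 1. Finite classes have product natural proofs -/

section FiniteClasses

variable {F : Type*} [Field F] {σ : Type*}

/-- **Natural proofs against a finite class (product distinguisher).** If `𝒞` is finite and every member of `𝒞`
differs from `h` in some `M`-coefficient, then the product over `g ∈ 𝒞` of the affine forms
`c_{m_g} - coeff_{m_g}(g)` is an `M`-natural proof against `𝒞` of degree `≤ |𝒞|`, nonzero at `h`
(FSV Def. 1 with `𝒟 = {D : deg D ≤ |𝒞|}`). [cite: ForbesShpilkaVolk2018, Def. 1] -/
theorem exists_isNaturalProof_of_finite (M : Set (σ →₀ ℕ)) {𝒞 : Set (MvPolynomial σ F)}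
    (h𝒞 : 𝒞.Finite) (h : MvPolynomial σ F) (hsep : ∀ g ∈ 𝒞, ∃ m ∈ M, coeff m g ≠ coeff m h) :
    ∃ D : MvPolynomial M F, IsNaturalProof M 𝒞 {D | D.totalDegree ≤ 𝒞.ncard} D ∧
      eval (coeffVector M h) D ≠ 0 := by
  classical
  choose! μ hμM hμ using hsep
  let ℓ : MvPolynomial σ F → MvPolynomial M F := fun g =>
    if hg : g ∈ 𝒞 then X ⟨μ g, hμM g hg⟩ - C (coeff (μ g) g) else 1
  have hℓC : ∀ g ∈ 𝒞, eval (coeffVector M g) (ℓ g) = 0 := by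
    intro g hg
    simp only [ℓ, dif_pos hg, map_sub, eval_X, eval_C, coeffVector_apply, sub_self]
  have hℓh : ∀ g ∈ 𝒞, eval (coeffVector M h) (ℓ g) ≠ 0 := by
    intro g hg
    simp only [ℓ, dif_pos hg, map_sub, eval_X, eval_C, coeffVector_apply]
    exact sub_ne_zero.2 (hμ g hg).symm
  have hℓdeg : ∀ g, (ℓ g).totalDegree ≤ 1 := by
    intro g
    by_cases hg : g ∈ 𝒞
    · simp only [ℓ, dif_pos hg]
      refine (totalDegree_sub _ _).trans (max_le ?_ ?_)
      · exact (totalDegree_X _).le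
      · simp
    · simp [ℓ, dif_neg hg]
  set D : MvPolynomial M F := ∏ g ∈ h𝒞.toFinset, ℓ g with hD
  have hevh : eval (coeffVector M h) D ≠ 0 := by
    rw [hD, map_prod]
    exact Finset.prod_ne_zero_iff.2 fun g hg => hℓh g (h𝒞.mem_toFinset.1 hg)
  refine ⟨D, ⟨?_, fun h0 => hevh (by rw [h0, map_zero]), fun f hf => ?_⟩, hevh⟩
  · show D.totalDegree ≤ 𝒞.ncard
    rw [Set.ncard_eq_toFinset_card 𝒞 h𝒞, hD]
    refine (totalDegree_finsetProd _ _).trans ?_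
    calc ∑ g ∈ h𝒞.toFinset, (ℓ g).totalDegree ≤ ∑ g ∈ h𝒞.toFinset, 1 :=
          Finset.sum_le_sum fun g _ => hℓdeg g
      _ = h𝒞.toFinset.card := by simp
  · rw [hD, map_prod]
    exact Finset.prod_eq_zero (h𝒞.mem_toFinset.2 hf) (hℓC f hf)

/-- **Soundness**: a natural proof against `𝒞` that is nonzero at `h` certifies `h ∉ 𝒞`
(FSV §1.2, usefulness). [cite: ForbesShpilkaVolk2018, Def. 1] -/
theorem not_mem_of_isNaturalProof {K : Type*} [CommSemiring K] {M : Set (σ →₀ ℕ)}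
    {𝒞 : Set (MvPolynomial σ K)} {𝒟 : Set (MvPolynomial M K)} {D : MvPolynomial M K}
    (hD : IsNaturalProof M 𝒞 𝒟 D) {h : MvPolynomial σ K} (hh : eval (coeffVector M h) D ≠ 0) : h ∉ 𝒞 :=
  fun hm => hh (hD.2.2 h hm)

/-- Over ALL monomials (`M = univ`) the separation hypothesis is just `h ∉ 𝒞`: non-membership in a finite class
and the existence of a degree-`≤ |𝒞|` natural proof nonzero at `h` are EQUIVALENT.
[cite: ForbesShpilkaVolk2018, Def. 1 and Thm. 4] -/
theorem not_mem_iff_exists_isNaturalProof {𝒞 : Set (MvPolynomial σ F)} (h𝒞 : 𝒞.Finite)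
    (h : MvPolynomial σ F) :
    h ∉ 𝒞 ↔ ∃ D : MvPolynomial (Set.univ : Set (σ →₀ ℕ)) F,
      IsNaturalProof Set.univ 𝒞 {D | D.totalDegree ≤ 𝒞.ncard} D ∧ eval (coeffVector Set.univ h) D ≠ 0 := by
  refine ⟨fun hn => exists_isNaturalProof_of_finite Set.univ h𝒞 h fun g hg => ?_,
    fun ⟨D, hD, hh⟩ => not_mem_of_isNaturalProof hD hh⟩
  have hne : g ≠ h := fun e => hn (e ▸ hg)
  by_contra hcon
  push Not at hcon
  exact hne (MvPolynomial.ext _ _ fun m => hcon m (Set.mem_univ m))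

end FiniteClasses

/-! ### 2. The notches of the description dial as finite classes of polynomials -/

section Classes

/-- The class at notch `(β, Δ)`, length `n`, exponent `c`: polynomials in the `n²` matrix variables computed (over `ℂ`)
by a constant-free integer circuit of product-depth `≤ Δ n` and `≤ n^c + c` wires whose code word is read off a
`w`-bit address (`|code| ≤ 2^w`) by a `B₂`-circuit with `≤ β n c` gates — the body of `PerEasySuccinctCF β Δ` with
`PER_n` replaced by a variable polynomial. [cite: JansenSanthanam2011, §1] -/
def SuccinctClass (β : ℕ → ℕ → ℕ) (Δ : ℕ → ℕ) (n c : ℕ) : Set (MvPolynomial (Fin n × Fin n) ℂ) :=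
  {f | ∃ C : ArithCircuit ℤ (Fin (n * n)), ∃ C' : ArithCircuit ℂ (Fin n × Fin n),
    C' = (C.map (Int.castRingHom ℂ)).rename ⇑(finProdFinEquiv (m := n) (n := n)).symm ∧
    C.HasSignConstants ∧ C'.Computes f ∧ C'.productDepth ≤ Δ n ∧
    C'.edgeSize ≤ n ^ c + c ∧
    ∃ w : ℕ, (encodeArithCircuit (n * n) C).length ≤ 2 ^ w ∧
      ∃ D : Literature.Computability.Complexity.Circuit (Fin w),
        D.IsOver Literature.Computability.Complexity.B2 ∧ D.size ≤ β n c ∧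
          D.Computes fun a =>
            (encodeArithCircuit (n * n) C).getD (∑ t : Fin w, if a t then 2 ^ (t : ℕ) else 0) false}

/-- The constant-free class (no description constraint): the body of `PerEasyCF Δ` with `PER_n` replaced by a
variable polynomial. [cite: Burgisser2000, Def. 2.1] -/
def CFClass (Δ : ℕ → ℕ) (n c : ℕ) : Set (MvPolynomial (Fin n × Fin n) ℂ) :=
  {f | ∃ C : ArithCircuit ℤ (Fin (n * n)), ∃ C' : ArithCircuit ℂ (Fin n × Fin n),
    C' = (C.map (Int.castRingHom ℂ)).rename ⇑(finProdFinEquiv (m := n) (n := n)).symm ∧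
    C.HasSignConstants ∧ C'.Computes f ∧ C'.productDepth ≤ Δ n ∧ C'.edgeSize ≤ n ^ c + c}

/-- The dial as class membership of the permanent (definitional). [cite: JansenSanthanam2011, §1] -/
theorem perEasySuccinctCF_iff_mem (β : ℕ → ℕ → ℕ) (Δ : ℕ → ℕ) :
    PerEasySuccinctCF β Δ ↔ ∃ c : ℕ, ∀ n : ℕ, perPoly (Fin n) ℂ ∈ SuccinctClass β Δ n c :=
  Iff.rfl

/-- The constant-free notch as class membership of the permanent (definitional). [cite: Burgisser2000, Def. 2.1] -/
theorem perEasyCF_iff_mem (Δ : ℕ → ℕ) :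
    PerEasyCF Δ ↔ ∃ c : ℕ, ∀ n : ℕ, perPoly (Fin n) ℂ ∈ CFClass Δ n c :=
  Iff.rfl

/-- Forgetting the description: every notch lies inside the constant-free class. [folklore] -/
theorem succinctClass_subset_cfClass (β : ℕ → ℕ → ℕ) (Δ : ℕ → ℕ) (n c : ℕ) :
    SuccinctClass β Δ n c ⊆ CFClass Δ n c := by
  rintro f ⟨C, C', h1, h2, h3, h4, h5, -⟩
  exact ⟨C, C', h1, h2, h3, h4, h5⟩

/-- The code-length budget of the constant-free class: `L = 8 (n² + (n^c + c) + 27)²`.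
[cite: Burgisser2000, §1.4] -/
def codeLen (n c : ℕ) : ℕ := 8 * (n * n + (n ^ c + c) + 27) ^ 2

/-- **The constant-free class is parametrised by short code words**: every member is the (renamed, complexified)
value of a constant-free circuit whose code word has length `≤ L` (pass to the normal form of
`exists_normalForm_signConst`, then `length_encodeArithCircuit_le_sq`). [cite: Burgisser2000, §1.4] -/
theorem cfClass_subset_image (Δ : ℕ → ℕ) (n c : ℕ) :
    CFClass Δ n c ⊆ (fun N : ArithCircuit ℤ (Fin (n * n)) =>
        MvPolynomial.rename ⇑(finProdFinEquiv (m := n) (n := n)).symm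
          (MvPolynomial.map (Int.castRingHom ℂ) N.eval)) ''
      {N | (encodeArithCircuit (n * n) N).length ≤ codeLen n c} := by
  rintro f ⟨C, C', rfl, hs, hf, -, hw⟩
  obtain ⟨N, hNwf, hNs, hNe, -, hNedge, hNsize⟩ := exists_normalForm_signConst C hs
  rw [DepthThreeChasm.edgeSize_rename, ArithCircuit.edgeSize_mapCoeff] at hw
  refine ⟨N, ?_, ?_⟩
  · show (encodeArithCircuit (n * n) N).length ≤ 8 * (n * n + (n ^ c + c) + 27) ^ 2
    refine (length_encodeArithCircuit_le_sq N hNwf hNs hNsize).trans ?_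
    have : N.edgeSize ≤ n ^ c + c := hNedge.trans hw
    gcongr
  · show MvPolynomial.rename _ (MvPolynomial.map _ N.eval) = f
    unfold ArithCircuit.Computes at hf
    rw [hNe, ← ArithCircuit.eval_map_apply, ← ArithCircuit.eval_rename_apply, hf]

/-- The set of circuits with code words of length `≤ L` is finite (the encoding is injective).
[cite: Burgisser2000, §1.4] -/
theorem finite_setOf_codeLen_le (N L : ℕ) :
    {C : ArithCircuit ℤ (Fin N) | (encodeArithCircuit N C).length ≤ L}.Finite :=
  (List.finite_length_le Bool L).preimage (Set.injOn_of_injective (encodeArithCircuit_injective _))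

/-- Strings of length `≤ L` over `Bool`: at most `(L + 1) · 2^L`. [folklore] -/
theorem ncard_setOf_length_le (L : ℕ) : {l : List Bool | l.length ≤ L}.ncard ≤ (L + 1) * 2 ^ L := by
  classical
  have hmaps : ∀ l ∈ {l : List Bool | l.length ≤ L},
      (fun l : List Bool => ((⟨min l.length L, by omega⟩ : Fin (L + 1)), fun i : Fin L => l.getD i false)) l ∈
        (Set.univ : Set (Fin (L + 1) × (Fin L → Bool))) := fun _ _ => Set.mem_univ _
  have hinj : Set.InjOn
      (fun l : List Bool => ((⟨min l.length L, by omega⟩ : Fin (L + 1)), fun i : Fin L => l.getD i false))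
      {l : List Bool | l.length ≤ L} := by
    intro l hl l' hl' h
    simp only [Set.mem_setOf_eq] at hl hl'
    simp only [Prod.mk.injEq, Fin.mk.injEq] at h
    obtain ⟨hlen, hfun⟩ := h
    rw [Nat.min_eq_left hl, Nat.min_eq_left hl'] at hlen
    refine List.ext_getElem hlen fun i hi hi' => ?_
    have := congrFun hfun ⟨i, by omega⟩
    simp only at this
    rw [List.getD_eq_getElem _ _ hi, List.getD_eq_getElem _ _ hi'] at this
    exact this
  have h := Set.ncard_le_ncard_of_injOn _ hmaps hinj Set.finite_univ
  rw [Set.ncard_univ, Nat.card_eq_fintype_card, Fintype.card_prod, Fintype.card_fin, Fintype.card_pi,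
    Finset.prod_const, Fintype.card_bool, Finset.card_univ, Fintype.card_fin] at h
  exact h

/-- Circuits with short code words: at most `(L + 1) · 2^L`. [cite: Burgisser2000, §1.4] -/
theorem ncard_setOf_codeLen_le (N L : ℕ) :
    {C : ArithCircuit ℤ (Fin N) | (encodeArithCircuit N C).length ≤ L}.ncard ≤ (L + 1) * 2 ^ L := by
  have h := Set.ncard_le_ncard_of_injOn (encodeArithCircuit N)
    (s := {C : ArithCircuit ℤ (Fin N) | (encodeArithCircuit N C).length ≤ L})
    (t := {l : List Bool | l.length ≤ L}) (fun C hC => hC) (Set.injOn_of_injective (encodeArithCircuit_injective _))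
    (List.finite_length_le Bool L)
  exact h.trans (ncard_setOf_length_le L)

/-- **Every constant-free notch is a finite class.** [cite: Burgisser2000, §1.4] -/
theorem cfClass_finite (Δ : ℕ → ℕ) (n c : ℕ) : (CFClass Δ n c).Finite :=
  ((finite_setOf_codeLen_le (n * n) (codeLen n c)).image _).subset (cfClass_subset_image Δ n c)

/-- And its size is bounded by the number of short code words, WHATEVER the budget.
[cite: Burgisser2000, §1.4] -/
theorem ncard_cfClass_le (Δ : ℕ → ℕ) (n c : ℕ) :
    (CFClass Δ n c).ncard ≤ (codeLen n c + 1) * 2 ^ codeLen n c := by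
  refine (Set.ncard_le_ncard (cfClass_subset_image Δ n c)
    ((finite_setOf_codeLen_le (n * n) (codeLen n c)).image _)).trans ?_
  exact (Set.ncard_image_le (finite_setOf_codeLen_le (n * n) (codeLen n c))).trans
    (ncard_setOf_codeLen_le _ _)

/-- **Every notch of the description dial is a finite class.** [cite: JansenSanthanam2011, §1] -/
theorem succinctClass_finite (β : ℕ → ℕ → ℕ) (Δ : ℕ → ℕ) (n c : ℕ) : (SuccinctClass β Δ n c).Finite :=
  (cfClass_finite Δ n c).subset (succinctClass_subset_cfClass β Δ n c)

/-- Hence bounded in size by the constant-free class. [folklore] -/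
theorem ncard_succinctClass_le (β : ℕ → ℕ → ℕ) (Δ : ℕ → ℕ) (n c : ℕ) :
    (SuccinctClass β Δ n c).ncard ≤ (codeLen n c + 1) * 2 ^ codeLen n c :=
  (Set.ncard_le_ncard (succinctClass_subset_cfClass β Δ n c) (cfClass_finite Δ n c)).trans
    (ncard_cfClass_le Δ n c)

end Classes

/-! ### 3. The natural column: hardness at a notch IS a natural proof against the notch -/

section NaturalColumn

/-- **The natural column of the dial.** For every budget `β` and depth `Δ`: `PER` is hard for the notch iff for every
`c`, at some length `n`, there is an algebraically natural proof (FSV Def. 1, all monomials as coefficient variables,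
distinguishers of degree `≤ |SuccinctClass β Δ n c|`) against the notch's class that is nonzero at `PER_n`.
[cite: ForbesShpilkaVolk2018, Def. 1 and Thm. 4] -/
theorem perHardDesc_iff_natSep (β : ℕ → ℕ → ℕ) (Δ : ℕ → ℕ) :
    ¬ PerEasySuccinctCF β Δ ↔ ∀ c : ℕ, ∃ n : ℕ,
      ∃ D : MvPolynomial (Set.univ : Set ((Fin n × Fin n) →₀ ℕ)) ℂ,
        IsNaturalProof Set.univ (SuccinctClass β Δ n c)
            {D | D.totalDegree ≤ (SuccinctClass β Δ n c).ncard} D ∧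
          eval (coeffVector Set.univ (perPoly (Fin n) ℂ)) D ≠ 0 := by
  rw [perEasySuccinctCF_iff_mem, not_exists]
  refine forall_congr' fun c => ?_
  rw [not_forall]
  exact exists_congr fun n => not_mem_iff_exists_isNaturalProof (succinctClass_finite β Δ n c) _

/-- The same for the constant-free notch (no description constraint). [cite: ForbesShpilkaVolk2018, Def. 1 and Thm. 4] -/
theorem perHardCF_iff_natSep (Δ : ℕ → ℕ) :
    ¬ PerEasyCF Δ ↔ ∀ c : ℕ, ∃ n : ℕ,
      ∃ D : MvPolynomial (Set.univ : Set ((Fin n × Fin n) →₀ ℕ)) ℂ,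
        IsNaturalProof Set.univ (CFClass Δ n c) {D | D.totalDegree ≤ (CFClass Δ n c).ncard} D ∧
          eval (coeffVector Set.univ (perPoly (Fin n) ℂ)) D ≠ 0 := by
  rw [perEasyCF_iff_mem, not_exists]
  refine forall_congr' fun c => ?_
  rw [not_forall]
  exact exists_congr fun n => not_mem_iff_exists_isNaturalProof (cfClass_finite Δ n c) _

/-- **The crux `A` of the route, verbatim, is a natural-proof statement**: `SuccinctPerHardLog3` (budget `n + c`,
depth `Δ₁ = ⌊log₂ log₂ log₂ n⌋ + 1`) iff for every `c` some `PER_n` carries a natural proof of degree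
`≤ |SuccinctClass (n+c) Δ₁ n c|` against the notch. [cite: ForbesShpilkaVolk2018, Def. 1 and Thm. 4] -/
theorem succinctPerHardLog3_iff_natSep :
    ¬ PerEasySuccinctCF (fun n c => n + c) (fun n => Nat.log 2 (Nat.log 2 (Nat.log 2 n)) + 1) ↔
      ∀ c : ℕ, ∃ n : ℕ, ∃ D : MvPolynomial (Set.univ : Set ((Fin n × Fin n) →₀ ℕ)) ℂ,
        IsNaturalProof Set.univ
            (SuccinctClass (fun n c => n + c) (fun n => Nat.log 2 (Nat.log 2 (Nat.log 2 n)) + 1) n c)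
            {D | D.totalDegree ≤
              (SuccinctClass (fun n c => n + c) (fun n => Nat.log 2 (Nat.log 2 (Nat.log 2 n)) + 1) n c).ncard} D ∧
          eval (coeffVector Set.univ (perPoly (Fin n) ℂ)) D ≠ 0 :=
  perHardDesc_iff_natSep _ _

/-- **The top notch `PerHardLog3CF`, verbatim, is a natural-proof statement** against the constant-free class.
[cite: ForbesShpilkaVolk2018, Def. 1 and Thm. 4] -/
theorem perHardLog3CF_iff_natSep :
    ¬ PerEasyCF (fun n => Nat.log 2 (Nat.log 2 (Nat.log 2 n)) + 1) ↔
      ∀ c : ℕ, ∃ n : ℕ, ∃ D : MvPolynomial (Set.univ : Set ((Fin n × Fin n) →₀ ℕ)) ℂ,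
        IsNaturalProof Set.univ (CFClass (fun n => Nat.log 2 (Nat.log 2 (Nat.log 2 n)) + 1) n c)
            {D | D.totalDegree ≤ (CFClass (fun n => Nat.log 2 (Nat.log 2 (Nat.log 2 n)) + 1) n c).ncard} D ∧
          eval (coeffVector Set.univ (perPoly (Fin n) ℂ)) D ≠ 0 :=
  perHardCF_iff_natSep _

/-- **Natural proofs transfer DOWN the dial for free**: a natural proof against the constant-free class is one
against every notch (classes shrink as the budget shrinks; FSV's monotonicity in `𝒞`). [cite: ForbesShpilkaVolk2018, Thm. 4] -/
theorem isNaturalProof_succinctClass_of_cfClass {β : ℕ → ℕ → ℕ} {Δ : ℕ → ℕ} {n c : ℕ}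
    {M : Set ((Fin n × Fin n) →₀ ℕ)} {𝒟 : Set (MvPolynomial M ℂ)} {D : MvPolynomial M ℂ}
    (hD : IsNaturalProof M (CFClass Δ n c) 𝒟 D) : IsNaturalProof M (SuccinctClass β Δ n c) 𝒟 D :=
  ⟨hD.1, hD.2.1, fun f hf => hD.2.2 f (succinctClass_subset_cfClass β Δ n c hf)⟩

end NaturalColumn

/-! ### 4. The width-pinned dial: `A ⟹ A′`, and `A′` is a natural proof of budget-sensitive degree -/

section PinnedNotch

/-- A pinned witness is a witness: `PinnedClass Δ n c w s ⊆ SuccinctClass β Δ n c` when `s ≤ β n c`. [folklore] -/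
theorem pinnedClass_subset_succinctClass {β : ℕ → ℕ → ℕ} {Δ : ℕ → ℕ} {n c w s : ℕ} (hs : s ≤ β n c) :
    PinnedClass Δ n c w s ⊆ SuccinctClass β Δ n c := by
  rintro f ⟨C, C', h1, h2, h3, h4, h5, hw, D, hD1, hD2, hD3⟩
  exact ⟨C, C', h1, h2, h3, h4, h5, w, hw, D, hD1, hD2.trans hs, hD3⟩

/-- Conversely every member of the notch is pinned at the width of one of its witnesses. [folklore] -/
theorem mem_pinnedClass_of_mem_succinctClass {β : ℕ → ℕ → ℕ} {Δ : ℕ → ℕ} {n c : ℕ}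
    {f : MvPolynomial (Fin n × Fin n) ℂ} (hf : f ∈ SuccinctClass β Δ n c) :
    ∃ w : ℕ, f ∈ PinnedClass Δ n c w (β n c) := by
  obtain ⟨C, C', h1, h2, h3, h4, h5, w, hw, D, hD1, hD2, hD3⟩ := hf
  exact ⟨w, C, C', h1, h2, h3, h4, h5, hw, D, hD1, hD2, hD3⟩

/-- The CANONICAL address width of the notch `(n, c)`: `⌊log₂ L⌋ + 1` bits address every position of a code word
of length `≤ L = codeLen n c` (the length of every normal-form witness). [cite: ChenKabanets2012, Def. 2.1] -/
def canonWidth (n c : ℕ) : ℕ := Nat.log 2 (codeLen n c) + 1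

/-- `codeLen n c < 2 ^ canonWidth n c`. [folklore] -/
theorem codeLen_lt_two_pow_canonWidth (n c : ℕ) : codeLen n c < 2 ^ canonWidth n c :=
  Nat.lt_pow_succ_log_self (by norm_num) _

/-- Pinned easiness is easiness.  EASINESS AT THE WIDTH-PINNED NOTCH (`A′`-side) is
`∃ c, ∀ n, PER_n ∈ PinnedClass Δ n c (canonWidth n c) (β n c)`: description budget `β n c` at the canonical width,
code word of length `≤ 2 ^ canonWidth n c` (no heavy padding). [cite: ChenKabanets2012, Def. 2.1] -/
theorem perEasySuccinctCF_of_pinned {β : ℕ → ℕ → ℕ} {Δ : ℕ → ℕ}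
    (h : ∃ c : ℕ, ∀ n : ℕ, perPoly (Fin n) ℂ ∈ PinnedClass Δ n c (canonWidth n c) (β n c)) :
    PerEasySuccinctCF β Δ := by
  obtain ⟨c, hc⟩ := h
  exact (perEasySuccinctCF_iff_mem β Δ).2 ⟨c, fun n => pinnedClass_subset_succinctClass le_rfl (hc n)⟩

/-- **`A ⟹ A′`**: hardness at a notch implies hardness at the width-pinned notch of the same budget (the converse —
removal of heavy PADDING by empty gates at no cost in the description budget — is NOT claimed). [folklore] -/
theorem perHardPinned_of_perHardSuccinct {β : ℕ → ℕ → ℕ} {Δ : ℕ → ℕ} (h : ¬ PerEasySuccinctCF β Δ) :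
    ¬ ∃ c : ℕ, ∀ n : ℕ, perPoly (Fin n) ℂ ∈ PinnedClass Δ n c (canonWidth n c) (β n c) :=
  fun h' => h (perEasySuccinctCF_of_pinned h')

/-- The pinned notch is finite. [folklore] -/
theorem pinnedClass_finite (Δ : ℕ → ℕ) (n c w s : ℕ) : (PinnedClass Δ n c w s).Finite :=
  (succinctClass_finite (fun _ _ => s) Δ n c).subset (pinnedClass_subset_succinctClass le_rfl)

/-- **`A′` IS A NATURAL PROOF OF BUDGET-SENSITIVE DEGREE.** For every budget `β` and depth `Δ`:
`(¬ ∃ c, ∀ n, PER_n ∈ PinnedClass Δ n c w₀ (β n c)) ↔ ∀ c, ∃ n, ∃ D`, `D` a natural proof against the pinned notch of degree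
`≤ (2 ^ w₀ + 1) · descCount w₀ (β n c)`, `w₀ = canonWidth n c`, with `D(PER_n) ≠ 0` — at `β n c = n + c` this degree
is `2^{O(n log n)} = N_n^{O(1)}`, `N_n = C(n² + n, n)` (route file §Gen 8). [cite: ForbesShpilkaVolk2018, Def. 1] -/
theorem perHardPinned_iff_natSep (β : ℕ → ℕ → ℕ) (Δ : ℕ → ℕ) :
    (¬ ∃ c : ℕ, ∀ n : ℕ, perPoly (Fin n) ℂ ∈ PinnedClass Δ n c (canonWidth n c) (β n c)) ↔
      ∀ c : ℕ, ∃ n : ℕ, ∃ D : MvPolynomial (Set.univ : Set ((Fin n × Fin n) →₀ ℕ)) ℂ,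
        IsNaturalProof Set.univ (PinnedClass Δ n c (canonWidth n c) (β n c))
            {D | D.totalDegree ≤ (2 ^ canonWidth n c + 1) * descCount (canonWidth n c) (β n c)} D ∧
          eval (coeffVector Set.univ (perPoly (Fin n) ℂ)) D ≠ 0 := by
  rw [not_exists]
  refine ⟨fun h c => ?_, fun h c hc => ?_⟩
  · obtain ⟨n, hn⟩ := not_forall.1 (h c)
    obtain ⟨D, hD, hev⟩ := (not_mem_iff_exists_isNaturalProof (pinnedClass_finite Δ n c _ _) _).1 hn
    exact ⟨n, D, ⟨hD.1.trans (ncard_pinnedClass_le Δ n c _ _), hD.2.1, hD.2.2⟩, hev⟩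
  · obtain ⟨n, D, hD, hev⟩ := h c
    exact not_mem_of_isNaturalProof hD hev (hc n)

end PinnedNotch

end

end Summit.ValiantsHypothesis.ValiantsHypothesis.Theorems.SuccinctLift
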